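import Literature.AlgebraicGeometry.Motives.HodgeLieWeightOnePlusLineTraceForm
import Literature.AlgebraicGeometry.Motives.HodgeLieWeightOnePlusLineKilling
import Literature.Algebra.Lie.Sl2TripleOfDimensionThree
import HarnessLib

/-!
# Weight one, type-III position, `Lie Hg` `ℚ`-simple of dimension `6`: the compact factor `𝔨` is an `sl₂` of trace `dim V`

Family `hodge`, layer `Literature/AlgebraicGeometry/Motives`; THEOREMS ONLY (no definition, no named fact; D-0026).
Sequel of `HodgeLieWeightOnePlusLineTraceForm` and `HodgeLieWeightOnePlusLineKilling` for the cell `pub-hodgecm2`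
(COR-CM) lane MT-RANK-SEVEN-TYPEIII, seat `b27`.

SETTING (type III): `H` polarizable of weight `1`, graded basis `e`, Hodge projector `P`, plus-line hypotheses
(`E F = αP`, `F E = α(1 − P)`), `𝔷 = 0`, `𝔥 = Lie Hg(H)` SIMPLE over `ℚ` with `dim_ℚ 𝔥 = 6` (Mumford–Tate rank `7`);
`𝔥_ℂ = 𝔰 ⊕ 𝔨`, `𝔰 = ⟨E, F, Θ⟩`, `𝔨 = {K ∈ 𝔥_ℂ : KP = PK, KE = EK}` of dimension `6 − 3 = 3`.

RESULTS.
* **`exists_sl2Triple_centraliser_of_plusLine`** — `𝔨` is spanned by an `sl₂`-triple `(h′, e′, f′)`: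
  `h′e′ − e′h′ = 2e′`, `h′f′ − f′h′ = −2f′`, `e′f′ − f′e′ = h′` (the `3`-dimensional Lie algebra `𝔨` is centre-free —
  `eq_zero_of_forall_commute_of_plusLine` — and carries the non-degenerate invariant symmetric trace form of `V_ℂ` —
  `eq_zero_of_forall_trace_mul_eq_zero_centraliser`; then `Sl2OfDimThree.exists_isSl2Triple_of_finrank_eq_three`).
* **`trace_sl2Triple_of_plusLine`** — for any such triple: `tr_{V_ℂ}(h′²) = dim_ℚ V` and `2 tr_{V_ℂ}(e′f′) = dim_ℚ V`.
  PROOF: in the adapted basis `(E, F, Θ, h′, e′, f′)` of `𝔥_ℂ` the ad-traces give `κ(h′, h′) = 8`, `κ(e′, f′) = 4`, and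
  `8 tr(xy) = dim V · κ(x, y)` on `𝔥_ℂ` (`eight_mul_trace_mul_eq_finrank_mul_killingForm_spanC`, the Galois swap by rational
  invariant forms).  Consequently `V_ℂ` is, as a representation of `𝔨 ≅ sl₂(ℂ)`, of the same trace type as the standard
  representation of `𝔰` — the input of the Casimir argument in the sequel `HodgeLieWeightOnePlusLineCasimir`.

## References

* [MoonenZarhin1999LowDim] B. Moonen, Yu. Zarhin, *Hodge classes on abelian varieties of low dimension*, Math. Ann. 315
  (1999), §2 (2.3) Type III.
* [Deligne1982HodgeCycles] P. Deligne, *Hodge cycles on abelian varieties*, LNM 900 (1982), I §3 (3.4–3.6).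
* [Humphreys1972] J. E. Humphreys, GTM 9 (1972), §5.1, §8.3.
* [Jacobson1962LieAlgebras] N. Jacobson, *Lie Algebras* (1962), Ch. I §4, Ch. X §1.
-/

noncomputable section

open scoped TensorProduct

namespace Literature.AlgebraicGeometry.Motives

universe u

namespace HodgeStructure

open ProjectorBlocks Literature.RepresentationTheory.GeneralLinear

variable {V : Type u} [AddCommGroup V] [Module ℚ V] [Module.Finite ℚ V] [HodgeTensorFacts.{u, u}] {n : ℤ}
  {S : Type u} [Fintype S] [DecidableEq S] {deg : S → ℤ}

/-! ## §1 The `sl₂`-triple spanning `𝔨` -/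

/-- **`𝔨 = {K ∈ 𝔥_ℂ : KP = PK, KE = EK}` is spanned by an `sl₂`-triple** when `𝔷 = 0`, `dim_ℚ Lie Hg = 6` and the grading is
in the plus-line position: `𝔨` is a `3`-dimensional (`finrank_centraliser_add_three`) centre-free
(`eq_zero_of_forall_commute_of_plusLine`) complex Lie algebra with the non-degenerate invariant symmetric form `tr_{V_ℂ}(K K')`
(`eq_zero_of_forall_trace_mul_eq_zero_centraliser`), hence an `sl₂(ℂ)`. [cite: MoonenZarhin1999LowDim, §2 (2.3)]
[cite: Jacobson1962LieAlgebras, Ch. I §4] [cite: Deligne1982HodgeCycles, I §3 (3.4–3.6)] -/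
theorem exists_sl2Triple_centraliser_of_plusLine (H : HodgeStructure V n) (ψ : H.Polarization) (hn : n = 1)
    (e : Module.Basis S ℂ (ℂ ⊗[ℚ] V)) (hF : ∀ a, H.F a = Submodule.span ℂ (e '' {σ | a ≤ deg σ}))
    (hFc : ∀ a, complexConj (H.F a) = Submodule.span ℂ (e '' {σ | deg σ ≤ n - a}))
    (hdeg : ∀ σ, deg σ = 0 ∨ deg σ = 1) {X : Module.End ℚ V} (hX : X ∈ H.hodgeLie) (hXE : X ∉ H.endAlg)
    (hplus : ∀ Y ∈ H.hodgeLieC, ∃ c : ℂ,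
      gradingEnd e deg * Y * (1 - gradingEnd e deg) = c • (gradingEnd e deg * X.baseChange ℂ * (1 - gradingEnd e deg)))
    (hminus : ∀ Y ∈ H.hodgeLieC, ∃ c : ℂ,
      (1 - gradingEnd e deg) * Y * gradingEnd e deg = c • ((1 - gradingEnd e deg) * X.baseChange ℂ * gradingEnd e deg))
    (hz : H.hodgeLie ⊓ Subalgebra.toSubmodule H.endAlg = ⊥) (h6 : Module.finrank ℚ H.hodgeLie = 6) :
    ∃ h' e' f' : Module.End ℂ (ℂ ⊗[ℚ] V),
      (h' ∈ H.hodgeLieC ∧ h' * gradingEnd e deg = gradingEnd e deg * h' ∧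
        h' * (gradingEnd e deg * X.baseChange ℂ * (1 - gradingEnd e deg)) =
          (gradingEnd e deg * X.baseChange ℂ * (1 - gradingEnd e deg)) * h') ∧
      (e' ∈ H.hodgeLieC ∧ e' * gradingEnd e deg = gradingEnd e deg * e' ∧
        e' * (gradingEnd e deg * X.baseChange ℂ * (1 - gradingEnd e deg)) =
          (gradingEnd e deg * X.baseChange ℂ * (1 - gradingEnd e deg)) * e') ∧
      (f' ∈ H.hodgeLieC ∧ f' * gradingEnd e deg = gradingEnd e deg * f' ∧
        f' * (gradingEnd e deg * X.baseChange ℂ * (1 - gradingEnd e deg)) =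
          (gradingEnd e deg * X.baseChange ℂ * (1 - gradingEnd e deg)) * f') ∧
      h' * e' - e' * h' = (2 : ℂ) • e' ∧ h' * f' - f' * h' = -((2 : ℂ) • f') ∧ e' * f' - f' * e' = h' ∧
      ∀ K ∈ H.hodgeLieC, K * gradingEnd e deg = gradingEnd e deg * K →
        K * (gradingEnd e deg * X.baseChange ℂ * (1 - gradingEnd e deg)) =
          (gradingEnd e deg * X.baseChange ℂ * (1 - gradingEnd e deg)) * K →
        ∃ a b c : ℂ, K = a • h' + b • e' + c • f' := by
  letI : LieRing (Module.End ℂ (ℂ ⊗[ℚ] V)) := LieRing.ofAssociativeRing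
  classical
  have hfin := finrank_centraliser_add_three H hn e hF hFc hdeg hX hXE hplus hminus
  rw [h6] at hfin
  set P := gradingEnd e deg with hP
  set E := P * X.baseChange ℂ * (1 - P) with hEdef
  -- commutators of operators commuting with `Q` commute with `Q`
  have hcomm : ∀ {a b Q : Module.End ℂ (ℂ ⊗[ℚ] V)}, a * Q = Q * a → b * Q = Q * b →
      (a * b - b * a) * Q = Q * (a * b - b * a) := by
    intro a b Q haQ hbQ
    rw [sub_mul, mul_sub, mul_assoc a b Q, hbQ, ← mul_assoc a Q b, haQ, mul_assoc Q a b, mul_assoc b a Q, haQ,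
      ← mul_assoc b Q a, hbQ, mul_assoc Q b a]
  -- the Lie algebra `𝔨'`
  obtain ⟨𝔨', h𝔨'⟩ : ∃ 𝔨' : LieSubalgebra ℂ (Module.End ℂ (ℂ ⊗[ℚ] V)),
      ∀ Z, Z ∈ 𝔨' ↔ Z ∈ H.hodgeLieC ∧ Z * P = P * Z ∧ Z * E = E * Z := by
    refine ⟨{ carrier := {Z | Z ∈ H.hodgeLieC ∧ Z * P = P * Z ∧ Z * E = E * Z}
              add_mem' := ?_, zero_mem' := ?_, smul_mem' := ?_, lie_mem' := ?_ }, fun Z => Iff.rfl⟩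
    · rintro a b ⟨ha, haP, haE⟩ ⟨hb, hbP, hbE⟩
      exact ⟨add_mem ha hb, by rw [add_mul, mul_add, haP, hbP], by rw [add_mul, mul_add, haE, hbE]⟩
    · exact ⟨zero_mem _, by rw [zero_mul, mul_zero], by rw [zero_mul, mul_zero]⟩
    · rintro c a ⟨ha, haP, haE⟩
      exact ⟨Submodule.smul_mem _ c ha, by rw [smul_mul_assoc, mul_smul_comm, haP],
        by rw [smul_mul_assoc, mul_smul_comm, haE]⟩
    · rintro a b ⟨ha, haP, haE⟩ ⟨hb, hbP, hbE⟩
      rw [LieRing.of_associative_ring_bracket]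
      exact ⟨H.commutator_mem_hodgeLieC ha hb, hcomm haP hbP, hcomm haE hbE⟩
  haveI : Module.Finite ℂ 𝔨' := Module.Finite.of_injective 𝔨'.toSubmodule.subtype Subtype.val_injective
  -- `dim 𝔨' = 3`
  have hks : 𝔨'.toSubmodule = H.hodgeLieC ⊓
      Module.End.eigenspace (LinearMap.mulLeft ℂ P - LinearMap.mulRight ℂ P) 0 ⊓
      Module.End.eigenspace (LinearMap.mulLeft ℂ E - LinearMap.mulRight ℂ E) 0 := by
    ext Z
    rw [LieSubalgebra.mem_toSubmodule, h𝔨', Submodule.mem_inf, Submodule.mem_inf, mem_eigenspace_adP_zero_iff,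
      mem_eigenspace_adP_zero_iff]
    constructor
    · rintro ⟨h1, h2, h3⟩; exact ⟨⟨h1, h2.symm⟩, h3.symm⟩
    · rintro ⟨⟨h1, h2⟩, h3⟩; exact ⟨h1, h2.symm, h3.symm⟩
  have h3' : Module.finrank ℂ 𝔨'.toSubmodule = 3 := by rw [hks]; omega
  have h3 : Module.finrank ℂ 𝔨' = 3 := h3'
  -- `𝔨'` is centre-free
  have hzk : ∀ x : 𝔨', (∀ y : 𝔨', ⁅x, y⁆ = 0) → x = 0 := by
    intro x hx
    obtain ⟨hxM, hxP, hxE⟩ := (h𝔨' x).1 x.2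
    rw [← LieSubalgebra.coe_zero_iff_zero]
    refine eq_zero_of_forall_commute_of_plusLine H ψ hn e hF hFc hdeg hX hXE hplus hminus hz hxM hxP hxE
      fun Z' hZ'M hZ'P hZ'E => ?_
    have h := hx ⟨Z', (h𝔨' Z').2 ⟨hZ'M, hZ'P, hZ'E⟩⟩
    rw [← LieSubalgebra.coe_zero_iff_zero, LieSubalgebra.coe_bracket, LieRing.of_associative_ring_bracket] at h
    exact sub_eq_zero.1 h
  -- the trace form of `V_ℂ` on `𝔨'`: symmetric, invariant, non-degenerate
  obtain ⟨B, hB⟩ : ∃ B : LinearMap.BilinForm ℂ 𝔨', B = LieModule.traceForm ℂ 𝔨' (ℂ ⊗[ℚ] V) := ⟨_, rfl⟩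
  have hBapply : ∀ x y : 𝔨', B x y =
      LinearMap.trace ℂ (ℂ ⊗[ℚ] V) ((x : Module.End ℂ (ℂ ⊗[ℚ] V)) * y) := by
    intro x y
    rw [hB, LieModule.traceForm_apply_apply]
    rfl
  have hBs : B.IsSymm := ⟨fun x y => by rw [hBapply, hBapply, LinearMap.trace_mul_comm]⟩
  have hBi : B.lieInvariant 𝔨' := by rw [hB]; exact LieModule.traceForm_lieInvariant ℂ 𝔨' (ℂ ⊗[ℚ] V)
  have hR : B.SeparatingRight := by
    intro y hy
    obtain ⟨hyM, hyP, hyE⟩ := (h𝔨' y).1 y.2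
    rw [← LieSubalgebra.coe_zero_iff_zero]
    exact eq_zero_of_forall_trace_mul_eq_zero_centraliser H ψ hn e hF hFc hdeg hX hXE hplus hminus hz hyM hyP hyE
      fun K' hK'M hK'P hK'E => by rw [← hBapply ⟨K', (h𝔨' K').2 ⟨hK'M, hK'P, hK'E⟩⟩ y]; exact hy _
  have hBn : B.Nondegenerate := ⟨fun x hx => hR x fun y => by rw [hBs.eq y x]; exact hx y, hR⟩
  -- the `sl₂`-triple
  obtain ⟨h₀, e₀, f₀, ht, hspan⟩ :=
    Literature.Algebra.Lie.Sl2OfDimThree.exists_isSl2Triple_of_finrank_eq_three h3 hBs hBn hBi hzk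
  have hHE := congrArg (fun T : 𝔨' => (T : Module.End ℂ (ℂ ⊗[ℚ] V))) (ht.lie_h_e_smul ℂ)
  have hHF := congrArg (fun T : 𝔨' => (T : Module.End ℂ (ℂ ⊗[ℚ] V))) (ht.lie_lie_smul_f ℂ)
  have hEF := congrArg (fun T : 𝔨' => (T : Module.End ℂ (ℂ ⊗[ℚ] V))) ht.lie_e_f
  simp only [LieSubalgebra.coe_bracket, LieRing.of_associative_ring_bracket, SetLike.val_smul,
    NegMemClass.coe_neg] at hHE hHF hEF
  refine ⟨h₀, e₀, f₀, (h𝔨' _).1 h₀.2, (h𝔨' _).1 e₀.2, (h𝔨' _).1 f₀.2, hHE, hHF, hEF, fun K hKM hKP hKE => ?_⟩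
  obtain ⟨a, b, c, habc⟩ := hspan ⟨K, (h𝔨' K).2 ⟨hKM, hKP, hKE⟩⟩
  refine ⟨a, b, c, ?_⟩
  have h := congrArg (fun T : 𝔨' => (T : Module.End ℂ (ℂ ⊗[ℚ] V))) habc
  simpa only [AddMemClass.coe_add, SetLike.val_smul] using h

/-! ## §2 The traces `tr(h′²) = dim V`, `2 tr(e′f′) = dim V` -/

omit [HodgeTensorFacts.{u, u}] in
/-- `tr T = Σ cᵢ` for an operator diagonal in a basis (`T bᵢ = cᵢ bᵢ`). Private plumbing. [folklore] -/
private theorem trace_eq_sum_of_apply_basis {R ι M : Type*} [CommRing R] [Fintype ι] [DecidableEq ι] [AddCommGroup M]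
    [Module R M] (b : Module.Basis ι R M) (T : M →ₗ[R] M) (c : ι → R) (hT : ∀ i, T (b i) = c i • b i) :
    LinearMap.trace R M T = ∑ i, c i := by
  rw [LinearMap.trace_eq_matrix_trace R b, Matrix.trace]
  refine Finset.sum_congr rfl fun i _ => ?_
  rw [Matrix.diag_apply, LinearMap.toMatrix_apply, hT, map_smul, b.repr_self, Finsupp.smul_apply,
    Finsupp.single_eq_same, smul_eq_mul, mul_one]

-- six basis cases with nested brackets, subtype coercions and a heavy ambient simp set: above the default budget when
-- elaborated inside larger import closures (measured: fine standalone, times out under `Summits.…` imports)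
set_option maxHeartbeats 800000 in
/-- **`tr_{V_ℂ}(h′²) = dim_ℚ V` and `2 tr_{V_ℂ}(e′f′) = dim_ℚ V` for every `sl₂`-triple `(h′, e′, f′)` spanning `𝔨`**
(type III, `𝔷 = 0`, `Lie Hg` `ℚ`-simple): in the adapted basis `(E, F, Θ, h′, e′, f′)` of `𝔥_ℂ`
(`exists_basis_plusLine_of_basis`) the ad-traces give `κ(h′, h′) = 8` and `κ(e′, f′) = 4`, and `8 tr(xy) = dim V · κ(x, y)` on
`𝔥_ℂ` (`eight_mul_trace_mul_eq_finrank_mul_killingForm_spanC`). [cite: MoonenZarhin1999LowDim, §2 (2.3)]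
[cite: Humphreys1972, §5.1 and §8.3] [cite: Deligne1982HodgeCycles, I §3 (3.4–3.6)] -/
theorem trace_sl2Triple_of_plusLine (H : HodgeStructure V n) (ψ : H.Polarization) (hn : n = 1)
    (e : Module.Basis S ℂ (ℂ ⊗[ℚ] V)) (hF : ∀ a, H.F a = Submodule.span ℂ (e '' {σ | a ≤ deg σ}))
    (hFc : ∀ a, complexConj (H.F a) = Submodule.span ℂ (e '' {σ | deg σ ≤ n - a}))
    (hdeg : ∀ σ, deg σ = 0 ∨ deg σ = 1) {X : Module.End ℚ V} (hX : X ∈ H.hodgeLie) (hXE : X ∉ H.endAlg)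
    (hplus : ∀ Y ∈ H.hodgeLieC, ∃ c : ℂ,
      gradingEnd e deg * Y * (1 - gradingEnd e deg) = c • (gradingEnd e deg * X.baseChange ℂ * (1 - gradingEnd e deg)))
    (hminus : ∀ Y ∈ H.hodgeLieC, ∃ c : ℂ,
      (1 - gradingEnd e deg) * Y * gradingEnd e deg = c • ((1 - gradingEnd e deg) * X.baseChange ℂ * gradingEnd e deg))
    (hz : H.hodgeLie ⊓ Subalgebra.toSubmodule H.endAlg = ⊥)
    (hsimple : letI : LieRing (Module.End ℚ V) := LieRing.ofAssociativeRing
      ∀ 𝔏 : LieSubalgebra ℚ (Module.End ℚ V), 𝔏.toSubmodule = H.hodgeLie → LieAlgebra.IsSimple ℚ 𝔏)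
    (h6 : Module.finrank ℚ H.hodgeLie = 6) {h' e' f' : Module.End ℂ (ℂ ⊗[ℚ] V)}
    (hh' : h' ∈ H.hodgeLieC ∧ h' * gradingEnd e deg = gradingEnd e deg * h' ∧
      h' * (gradingEnd e deg * X.baseChange ℂ * (1 - gradingEnd e deg)) =
        (gradingEnd e deg * X.baseChange ℂ * (1 - gradingEnd e deg)) * h')
    (he' : e' ∈ H.hodgeLieC ∧ e' * gradingEnd e deg = gradingEnd e deg * e' ∧
      e' * (gradingEnd e deg * X.baseChange ℂ * (1 - gradingEnd e deg)) =
        (gradingEnd e deg * X.baseChange ℂ * (1 - gradingEnd e deg)) * e')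
    (hf' : f' ∈ H.hodgeLieC ∧ f' * gradingEnd e deg = gradingEnd e deg * f' ∧
      f' * (gradingEnd e deg * X.baseChange ℂ * (1 - gradingEnd e deg)) =
        (gradingEnd e deg * X.baseChange ℂ * (1 - gradingEnd e deg)) * f')
    (hhe : h' * e' - e' * h' = (2 : ℂ) • e') (hhf : h' * f' - f' * h' = -((2 : ℂ) • f'))
    (hef : e' * f' - f' * e' = h')
    (hspan : ∀ K ∈ H.hodgeLieC, K * gradingEnd e deg = gradingEnd e deg * K →
      K * (gradingEnd e deg * X.baseChange ℂ * (1 - gradingEnd e deg)) =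
        (gradingEnd e deg * X.baseChange ℂ * (1 - gradingEnd e deg)) * K →
      ∃ a b c : ℂ, K = a • h' + b • e' + c • f') :
    LinearMap.trace ℂ (ℂ ⊗[ℚ] V) (h' * h') = (Module.finrank ℚ V : ℂ) ∧
      2 * LinearMap.trace ℂ (ℂ ⊗[ℚ] V) (e' * f') = (Module.finrank ℚ V : ℂ) := by
  letI : LieRing (Module.End ℂ (ℂ ⊗[ℚ] V)) := LieRing.ofAssociativeRing
  classical
  obtain ⟨hhM, hhP, hhE⟩ := hh'
  obtain ⟨heM, heP, heE⟩ := he'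
  obtain ⟨hfM, hfP, hfE⟩ := hf'
  -- the complexified Lie algebra `𝔏'` and the Galois-swap identity
  obtain ⟨𝔏', h𝔏'⟩ : ∃ 𝔏' : LieSubalgebra ℂ (Module.End ℂ (ℂ ⊗[ℚ] V)), 𝔏'.toSubmodule = H.hodgeLieC :=
    ⟨{ H.hodgeLieC with
        lie_mem' := fun {a b} ha hb => by
          rw [LieRing.of_associative_ring_bracket]
          exact H.commutator_mem_hodgeLieC ha hb }, rfl⟩
  have hkill := eight_mul_trace_mul_eq_finrank_mul_killingForm_spanC H ψ hn e hF hFc hdeg hX hXE hplus hminus hz hsimple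
    𝔏' h𝔏'
  have hfin := finrank_centraliser_add_three H hn e hF hFc hdeg hX hXE hplus hminus
  rw [h6] at hfin
  -- the centraliser `𝔨` and its basis `(h′, e′, f′)`
  set 𝔨 : Submodule ℂ (Module.End ℂ (ℂ ⊗[ℚ] V)) := H.hodgeLieC ⊓
    Module.End.eigenspace (LinearMap.mulLeft ℂ (gradingEnd e deg) - LinearMap.mulRight ℂ (gradingEnd e deg)) 0 ⊓
    Module.End.eigenspace (LinearMap.mulLeft ℂ (gradingEnd e deg * X.baseChange ℂ * (1 - gradingEnd e deg)) -
      LinearMap.mulRight ℂ (gradingEnd e deg * X.baseChange ℂ * (1 - gradingEnd e deg))) 0 with h𝔨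
  have hmem : ∀ Z, Z ∈ 𝔨 ↔ Z ∈ H.hodgeLieC ∧ Z * gradingEnd e deg = gradingEnd e deg * Z ∧
      Z * (gradingEnd e deg * X.baseChange ℂ * (1 - gradingEnd e deg)) =
        (gradingEnd e deg * X.baseChange ℂ * (1 - gradingEnd e deg)) * Z := fun Z => by
    rw [h𝔨, Submodule.mem_inf, Submodule.mem_inf, mem_eigenspace_adP_zero_iff, mem_eigenspace_adP_zero_iff]
    constructor
    · rintro ⟨⟨h1, h2⟩, h3⟩; exact ⟨h1, h2.symm, h3.symm⟩
    · rintro ⟨h1, h2, h3⟩; exact ⟨⟨h1, h2.symm⟩, h3.symm⟩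
  have h3 : Module.finrank ℂ 𝔨 = 3 := by omega
  obtain ⟨v, hv⟩ : ∃ v : Fin 3 → 𝔨, v = ![⟨h', (hmem _).2 ⟨hhM, hhP, hhE⟩⟩, ⟨e', (hmem _).2 ⟨heM, heP, heE⟩⟩,
      ⟨f', (hmem _).2 ⟨hfM, hfP, hfE⟩⟩] := ⟨_, rfl⟩
  have hv0 : ((v 0 : 𝔨) : Module.End ℂ (ℂ ⊗[ℚ] V)) = h' := by rw [hv]; rfl
  have hv1 : ((v 1 : 𝔨) : Module.End ℂ (ℂ ⊗[ℚ] V)) = e' := by rw [hv]; rfl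
  have hv2 : ((v 2 : 𝔨) : Module.End ℂ (ℂ ⊗[ℚ] V)) = f' := by rw [hv]; rfl
  have hvspan : ⊤ ≤ Submodule.span ℂ (Set.range v) := by
    rintro ⟨K, hK⟩ -
    obtain ⟨hKM, hKP, hKE⟩ := (hmem K).1 hK
    obtain ⟨a, b, c, habc⟩ := hspan K hKM hKP hKE
    have hKv : (⟨K, hK⟩ : 𝔨) = a • v 0 + b • v 1 + c • v 2 := by
      apply Subtype.ext
      rw [Submodule.coe_add, Submodule.coe_add, Submodule.coe_smul, Submodule.coe_smul, Submodule.coe_smul, hv0, hv1, hv2]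
      exact habc
    rw [hKv]
    exact Submodule.add_mem _ (Submodule.add_mem _ (Submodule.smul_mem _ _ (Submodule.subset_span ⟨0, rfl⟩))
      (Submodule.smul_mem _ _ (Submodule.subset_span ⟨1, rfl⟩))) (Submodule.smul_mem _ _ (Submodule.subset_span ⟨2, rfl⟩))
  have hcard : Fintype.card (Fin 3) = Module.finrank ℂ 𝔨 := by rw [Fintype.card_fin, h3]
  obtain ⟨b, hb0, hb1, hb2, hbr, hbk⟩ := exists_basis_plusLine_of_basis H hn e hF hFc hdeg hX hXE hplus hminus 𝔏' h𝔏'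
    (basisOfTopLeSpanOfCardEqFinrank v hvspan hcard)
  have hbh : (b (Sum.inr 0) : Module.End ℂ (ℂ ⊗[ℚ] V)) = h' := by
    rw [hbk, coe_basisOfTopLeSpanOfCardEqFinrank, hv0]
  have hbe : (b (Sum.inr 1) : Module.End ℂ (ℂ ⊗[ℚ] V)) = e' := by
    rw [hbk, coe_basisOfTopLeSpanOfCardEqFinrank, hv1]
  have hbf : (b (Sum.inr 2) : Module.End ℂ (ℂ ⊗[ℚ] V)) = f' := by
    rw [hbk, coe_basisOfTopLeSpanOfCardEqFinrank, hv2]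
  clear hbk hcard hvspan hv0 hv1 hv2 hv v h3 hmem hfin
  -- `𝔨` commutes with `E`, `F`, `Θ`
  have hkF : ∀ j, (b (Sum.inr j) : Module.End ℂ (ℂ ⊗[ℚ] V)) * ((1 - gradingEnd e deg) * X.baseChange ℂ * gradingEnd e deg) =
      ((1 - gradingEnd e deg) * X.baseChange ℂ * gradingEnd e deg) * b (Sum.inr j) ∧
      (b (Sum.inr j) : Module.End ℂ (ℂ ⊗[ℚ] V)) * ((2 : ℂ) • gradingEnd e deg - 1) =
        ((2 : ℂ) • gradingEnd e deg - 1) * b (Sum.inr j) := fun j =>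
    commute_of_plusLine H ψ hn e hF hFc hdeg hX hXE hplus hminus hz (hbr j).1 (hbr j).2
  have hk0 : ∀ j, ⁅b (Sum.inr j), b (Sum.inl 0)⁆ = 0 := fun j => by
    rw [← LieSubalgebra.coe_zero_iff_zero, LieSubalgebra.coe_bracket, LieRing.of_associative_ring_bracket, hb0,
      (hbr j).2, sub_self]
  have hk1 : ∀ j, ⁅b (Sum.inr j), b (Sum.inl 1)⁆ = 0 := fun j => by
    rw [← LieSubalgebra.coe_zero_iff_zero, LieSubalgebra.coe_bracket, LieRing.of_associative_ring_bracket, hb1,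
      (hkF j).1, sub_self]
  have hk2 : ∀ j, ⁅b (Sum.inr j), b (Sum.inl 2)⁆ = 0 := fun j => by
    rw [← LieSubalgebra.coe_zero_iff_zero, LieSubalgebra.coe_bracket, LieRing.of_associative_ring_bracket, hb2,
      (hkF j).2, sub_self]
  have hkl : ∀ j i, ⁅b (Sum.inr j), b (Sum.inl i)⁆ = 0 := fun j i => by
    obtain rfl | rfl | rfl : i = 0 ∨ i = 1 ∨ i = 2 := by fin_cases i <;> simp
    exacts [hk0 j, hk1 j, hk2 j]
  -- the `sl₂` relations inside `𝔏'`
  have hHE : ⁅b (Sum.inr 0), b (Sum.inr 1)⁆ = (2 : ℂ) • b (Sum.inr 1) := by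
    apply Subtype.ext
    rw [LieSubalgebra.coe_bracket, LieRing.of_associative_ring_bracket, SetLike.val_smul, hbh, hbe, hhe]
  have hHF : ⁅b (Sum.inr 0), b (Sum.inr 2)⁆ = (-2 : ℂ) • b (Sum.inr 2) := by
    apply Subtype.ext
    rw [LieSubalgebra.coe_bracket, LieRing.of_associative_ring_bracket, SetLike.val_smul, hbh, hbf, hhf, neg_smul]
  have hEF' : ⁅b (Sum.inr 1), b (Sum.inr 2)⁆ = b (Sum.inr 0) := by
    apply Subtype.ext
    rw [LieSubalgebra.coe_bracket, LieRing.of_associative_ring_bracket, hbe, hbf, hbh, hef]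
  have hEH : ⁅b (Sum.inr 1), b (Sum.inr 0)⁆ = (-2 : ℂ) • b (Sum.inr 1) := by rw [← lie_skew, hHE, neg_smul]
  have hFH : ⁅b (Sum.inr 2), b (Sum.inr 0)⁆ = (2 : ℂ) • b (Sum.inr 2) := by rw [← lie_skew, hHF, neg_smul, neg_neg]
  have hFE' : ⁅b (Sum.inr 2), b (Sum.inr 1)⁆ = -b (Sum.inr 0) := by rw [← lie_skew, hEF']
  -- `κ(h′, h′) = 8`
  have hκh : killingForm ℂ 𝔏' (b (Sum.inr 0)) (b (Sum.inr 0)) = 8 := by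
    rw [killingForm_apply_apply, trace_eq_sum_of_apply_basis b _
      (Sum.elim (fun _ => (0 : ℂ)) (fun j : Fin 3 => if j = 0 then 0 else 4)) ?_]
    · rw [Fintype.sum_sum_type, Fin.sum_univ_three, Fin.sum_univ_three]
      simp only [Sum.elim_inl, Sum.elim_inr, show (1 : Fin 3) ≠ 0 by decide, show (2 : Fin 3) ≠ 0 by decide, if_true,
        if_false]
      norm_num
    · rintro (i | j)
      · rw [LinearMap.comp_apply, LieAlgebra.ad_apply, LieAlgebra.ad_apply, hkl 0 i, lie_zero, Sum.elim_inl, zero_smul]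
      · rw [LinearMap.comp_apply, LieAlgebra.ad_apply, LieAlgebra.ad_apply, Sum.elim_inr]
        obtain rfl | rfl | rfl : j = 0 ∨ j = 1 ∨ j = 2 := by fin_cases j <;> simp
        · rw [lie_self, lie_zero, if_pos rfl, zero_smul]
        · rw [hHE, lie_smul, hHE, smul_smul, if_neg (by decide)]; norm_num
        · rw [hHF, lie_smul, hHF, smul_smul, if_neg (by decide)]; norm_num
  -- `κ(e′, f′) = 4`
  have hκef : killingForm ℂ 𝔏' (b (Sum.inr 1)) (b (Sum.inr 2)) = 4 := by
    rw [killingForm_apply_apply, trace_eq_sum_of_apply_basis b _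
      (Sum.elim (fun _ => (0 : ℂ)) (fun j : Fin 3 => if j = 2 then 0 else 2)) ?_]
    · rw [Fintype.sum_sum_type, Fin.sum_univ_three, Fin.sum_univ_three]
      simp only [Sum.elim_inl, Sum.elim_inr, show (0 : Fin 3) ≠ 2 by decide, show (1 : Fin 3) ≠ 2 by decide, if_true,
        if_false]
      norm_num
    · rintro (i | j)
      · rw [LinearMap.comp_apply, LieAlgebra.ad_apply, LieAlgebra.ad_apply, hkl 2 i, lie_zero, Sum.elim_inl, zero_smul]
      · rw [LinearMap.comp_apply, LieAlgebra.ad_apply, LieAlgebra.ad_apply, Sum.elim_inr]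
        obtain rfl | rfl | rfl : j = 0 ∨ j = 1 ∨ j = 2 := by fin_cases j <;> simp
        · rw [hFH, lie_smul, hEF', if_neg (by decide)]
        · rw [hFE', lie_neg, hEH, if_neg (by decide), neg_smul, neg_neg]
        · rw [lie_self, lie_zero, if_pos rfl, zero_smul]
  -- traces by the Galois swap
  have h1 := hkill (b (Sum.inr 0)) (b (Sum.inr 0))
  have h2 := hkill (b (Sum.inr 1)) (b (Sum.inr 2))
  rw [hbh, hκh] at h1
  rw [hbe, hbf, hκef] at h2
  constructor
  · linear_combination (1 / 8 : ℂ) * h1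
  · linear_combination (1 / 4 : ℂ) * h2

end HodgeStructure

end Literature.AlgebraicGeometry.Motives

end
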